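import Summits.QuantumFields.GaugeBoot.LinkLaplacianElimination
import Summits.QuantumFields.GaugeBoot.BootstrapWordBounds
import HarnessLib

/-!
# Strong-coupling order of the truncated bootstrap: the loop equations fix every word observable to `O(β^q)`, one power of `β` per four letters of level (gauge-boot, L1 supplement)

HONEST FRAMING (cell `pub-gaugeboot`, page 1 of every file): the venture produces certified bounds
on lattice expectations at stated coupling, gauge group, dimension and torus size; NOT a mass gap,
NOT a continuum limit, NOT a string tension; NOT Yang–Mills-summit-bearing (barriers
`FixedCouplingUltralocality`, `PerturbativeInvisibility`). Structural and QUALITATIVELY quantitative: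
the constants `C` below are not computed; no number is certified.

## Content (abstract lattice `ι`, compact group `G`, exponential one-link shifts `ρ(k_a t) = e^{t X_a}`)

Data: the family `k` exhausts `G`; finitely many directions `gen m` whose generators span all `X_a`;
a faithful `β = 0` functional `φ₀` (rows at `β = 0`, positive definite on polynomial squares — the
product Haar state); the derivatives `S' i a` of the local actions along the shifts, each a word
observable of degree `≤ 4` on a finite link set `T i` (plaquette terms). A linear `δ` satisfies the
HOMOGENEOUS ROWS at coupling `β` up to level `N` if `δ (D_{i,a} f) = β δ (f · S' i a)` for every
level-`N` test function `f` (word of length `≤ N`) — e.g. the difference of two solutions of the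
level-`N` truncated bootstrap (`IsBootstrapFeasible.rows_sderiv`).

* ★★ `apply_eq_mul_sum_of_rows` — ONE STEP: for `h ∈ wordSpace r S n` and `δ 1 = 0`,
  `δ h = β Σ_{i∈S} Σ_m δ ((D_{i,m} g) · S' i (gen m))` with `g` from
  `LinkLaplacianElimination.exists_eq_const_add_laplacian` (`h = c·1 + Σ D(D g)`, rows on `D g`);
* ★★★ `exists_const_abs_le_pow` — ITERATION: for every `h ∈ wordSpace r S n` and `q` there is
  `C ≥ 0` (independent of `β`, `δ`, the level) such that every `δ` with `δ 1 = 0`, homogeneous rows up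
  to level `N ≥ n + 4q - 4` and `|δ w| ≤ B` on words of length `≤ n + 4q` has `|δ h| ≤ C B |β|^q`;
* ★★★ `apply_eq_of_rows_zero` — `β = 0`: the rows ALONE (no positivity, no normalisation beyond
  `φ 1`) give `φ h = (φ₀ h / φ₀ 1) φ 1` — the level-`n` loop equations at `β = 0` determine every word
  of length `≤ n` (Haar value);
* ★★★ `exists_const_abs_sub_le_pow` — two level-`N` feasible functionals of the tree's truncated
  bootstrap (`BootstrapConvergence.IsBootstrapFeasible` with test functions `wordTruncation r N`)
  agree on `h` up to `C |β|^q` whenever `n + 4q ≤ N + 4` and `n + 4q ≤ 2N`: the WIDTH OF THE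
  LEVEL-`N` FEASIBLE INTERVAL of a length-`n` word observable is `O(|β|^{(N-n)/4+1})` as `β → 0` —
  the SDP bounds reproduce the strong-coupling expansion to that order. Instances for `SU(N)`/`U(N)`
  on the torus: `StrongCouplingOrderSuN.lean`.

NOT claimed: a rate in the level at FIXED `β` (the constants grow with `q`); values of `C`.
References: Yu. Makeenko, *Methods of contemporary gauge theory* (2002) §12, Problem 12.7 (iterative
strong-coupling solution of the lattice loop equation); P. Anderson, M. Kruczenski, Nucl. Phys. B 921
(2017) §3; V. Kazakov, Z. Zheng, arXiv:2203.11360 §4 (bounds vs. strong-coupling expansion). Folklore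
mechanism; the truncated finite-`N` statement appears to be new in this form.
-/

noncomputable section

open Filter Topology NormedSpace
open Literature.MathematicalPhysics.QuantumFieldTheory (LatticeRep)

namespace Summit.QuantumFields.GaugeBoot

variable {ι : Type*} [DecidableEq ι] {G : Type*} [Group G] [TopologicalSpace G] [ContinuousMul G]
  {r : LatticeRep G} {K : Type*} {k : K → ℝ → G} {X : K → Matrix (Fin r.N) (Fin r.N) ℂ}
  (hk : ∀ a s t, k a (s + t) = k a s * k a t) (hX : ∀ a t, r.ρ (k a t) = exp ((t : ℂ) • X a))
  (hexh : ∀ g : G, ∃ a t, k a t = g) {M : ℕ} (gen : Fin M → K)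
  (hspan : ∀ a, X a ∈ Submodule.span ℝ (Set.range fun m => X (gen m)))
  {φ₀ : C(ι → G, ℝ) →ₗ[ℝ] ℝ}
  (hrow : ∀ (i : ι) (a : K), ∀ f ∈ polyAlgebra (ι := ι) r, φ₀ (sderiv k i a f) = 0)
  (hnn : ∀ f ∈ polyAlgebra (ι := ι) r, 0 ≤ φ₀ (f * f))
  (hfaith : ∀ f ∈ polyAlgebra (ι := ι) r, φ₀ (f * f) = 0 → f = 0)
  {S' : ι → K → C(ι → G, ℝ)} {T : ι → Finset ι}
  (hS' : ∀ i a, S' i a ∈ wordSpace r (T i : Set ι) 4)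

/-! ## `β = 0`: the rows alone determine every word observable -/

include hk hX hexh gen hspan hrow hnn hfaith in
/-- ★★★ **At `β = 0` the level-`n` loop equations ALONE fix every word of length `≤ n`.** If a linear
`φ` kills the shift derivatives of all level-`n` test functions (the Schwinger–Dyson rows at `β = 0`;
no positivity, no other constraint), then `φ h = (φ₀ h / φ₀ 1) · φ 1` for every `h ∈ wordSpace r S n`
— with `φ 1 = 1`, the Haar expectation. [folklore] -/
theorem apply_eq_of_rows_zero (S : Finset ι) (n : ℕ) {φ : C(ι → G, ℝ) →ₗ[ℝ] ℝ}
    (hφ : ∀ (i : ι) (a : K), ∀ f ∈ wordTruncation (ι := ι) r n, φ (sderiv k i a f) = 0)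
    {h : C(ι → G, ℝ)} (hh : h ∈ wordSpace r (S : Set ι) n) : φ h = φ₀ h / φ₀ 1 * φ 1 := by
  obtain ⟨g, hg, hdec⟩ := exists_eq_const_add_laplacian hk hX hrow hnn hfaith hexh S n gen hspan hh
  have hz : ∀ i ∈ S, ∀ m : Fin M, φ (sderiv k i (gen m) (sderiv k i (gen m) g)) = 0 :=
    fun i _ m => hφ i (gen m) _ (mem_wordTruncation_of_mem_wordSpace r (sderiv_mem_wordSpace hk hX i _ hg))
  calc φ h = φ ((φ₀ h / φ₀ 1) • (1 : C(ι → G, ℝ)) +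
        ∑ i ∈ S, ∑ m : Fin M, sderiv k i (gen m) (sderiv k i (gen m) g)) := by rw [← hdec]
    _ = φ₀ h / φ₀ 1 * φ 1 := by
      rw [map_add, map_smul, smul_eq_mul, map_sum, Finset.sum_eq_zero fun i hi => ?_, add_zero]
      rw [map_sum]
      exact Finset.sum_eq_zero fun m _ => hz i hi m

/-! ## One step: a power of `β` for four letters -/

include hk hX hexh gen hspan hrow hnn hfaith in
/-- ★★ **One step.** For `h ∈ wordSpace r S n` there is `g ∈ wordSpace r S n` (from
`exists_eq_const_add_laplacian`, independent of `δ` and `β`) such that every linear `δ` with `δ 1 = 0`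
and the homogeneous rows at coupling `β` for the level-`n` test functions satisfies
`δ h = β · Σ_{i ∈ S} Σ_m δ ((D_{i, gen m} g) · S' i (gen m))`. [folklore] -/
theorem exists_forall_apply_eq_mul_sum (S : Finset ι) (n : ℕ) {h : C(ι → G, ℝ)}
    (hh : h ∈ wordSpace r (S : Set ι) n) :
    ∃ g ∈ wordSpace r (S : Set ι) n, ∀ (β : ℝ) (δ : C(ι → G, ℝ) →ₗ[ℝ] ℝ), δ 1 = 0 →
      (∀ (i : ι) (a : K), ∀ f ∈ wordTruncation (ι := ι) r n,
        δ (sderiv k i a f) = β * δ (f * S' i a)) →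
      δ h = β * ∑ i ∈ S, ∑ m : Fin M, δ (sderiv k i (gen m) g * S' i (gen m)) := by
  obtain ⟨g, hg, hdec⟩ := exists_eq_const_add_laplacian hk hX hrow hnn hfaith hexh S n gen hspan hh
  refine ⟨g, hg, fun β δ h1 hrows => ?_⟩
  have hz : ∀ i ∈ S, ∀ m : Fin M, δ (sderiv k i (gen m) (sderiv k i (gen m) g)) =
      β * δ (sderiv k i (gen m) g * S' i (gen m)) := fun i _ m =>
    hrows i (gen m) _ (mem_wordTruncation_of_mem_wordSpace r (sderiv_mem_wordSpace hk hX i _ hg))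
  calc δ h = δ ((φ₀ h / φ₀ 1) • (1 : C(ι → G, ℝ)) +
        ∑ i ∈ S, ∑ m : Fin M, sderiv k i (gen m) (sderiv k i (gen m) g)) := by rw [← hdec]
    _ = β * ∑ i ∈ S, ∑ m : Fin M, δ (sderiv k i (gen m) g * S' i (gen m)) := by
      rw [map_add, map_smul, h1, smul_zero, zero_add, map_sum, Finset.mul_sum]
      refine Finset.sum_congr rfl fun i hi => ?_
      rw [map_sum, Finset.mul_sum]
      exact Finset.sum_congr rfl fun m _ => hz i hi m

/-! ## Iteration: `|δ h| ≤ C B |β|^q` -/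

include hk hX hexh gen hspan hrow hnn hfaith hS' in
/-- ★★★ **Strong-coupling order of the homogeneous rows.** For every `h ∈ wordSpace r S n` (`S`
finite) and every `q` there is a constant `C ≥ 0` — depending on `h`, `q` and the fixed data only —
such that: every linear `δ` with `δ 1 = 0`, the homogeneous rows at coupling `β` for all test
functions of length `≤ N` where `n + 4q ≤ N + 4`, and `|δ w| ≤ B` for all words of length `≤ n + 4q`,
satisfies `|δ h| ≤ C · B · |β|^q`. [folklore] -/
theorem exists_const_abs_le_pow (q : ℕ) :
    ∀ (S : Finset ι) (n : ℕ) {h : C(ι → G, ℝ)}, h ∈ wordSpace r (S : Set ι) n →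
      ∃ C : ℝ, 0 ≤ C ∧ ∀ (N : ℕ), n + 4 * q ≤ N + 4 → ∀ (β B : ℝ) (δ : C(ι → G, ℝ) →ₗ[ℝ] ℝ),
        δ 1 = 0 →
        (∀ (i : ι) (a : K), ∀ f ∈ wordTruncation (ι := ι) r N,
          δ (sderiv k i a f) = β * δ (f * S' i a)) →
        (∀ w ∈ wordsUpTo (ι := ι) r (n + 4 * q), |δ w| ≤ B) → |δ h| ≤ C * B * |β| ^ q := by
  induction q with
  | zero =>
    intro S n h hh
    obtain ⟨C, hC0, hC⟩ := exists_const_abs_le_of_mem_span (s := wordsOn r (S : Set ι) n) hh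
    refine ⟨C, hC0, fun N _ β B δ _ _ hB => ?_⟩
    rw [pow_zero, mul_one]
    exact hC δ B fun w hw => hB w (by simpa using wordsOn_subset_wordsUpTo r _ _ hw)
  | succ q ih =>
    intro S n h hh
    classical
    obtain ⟨g, hg, hstep⟩ := exists_forall_apply_eq_mul_sum hk hX hexh gen hspan hrow hnn hfaith
      (S' := S') S n hh
    -- the next-generation observables and their constants
    have hmem : ∀ p : S × Fin M, sderiv k (p.1 : ι) (gen p.2) g * S' p.1 (gen p.2) ∈
        wordSpace r ((S ∪ T p.1 : Finset ι) : Set ι) (n + 4) := fun p =>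
      mul_mem_wordSpace r
        (wordSpace_mono r (by simp) le_rfl (sderiv_mem_wordSpace hk hX (p.1 : ι) (gen p.2) hg))
        (wordSpace_mono r (by simp) le_rfl (hS' p.1 (gen p.2)))
    choose C hC0 hC using fun p : S × Fin M => ih (S ∪ T p.1) (n + 4) (hmem p)
    refine ⟨∑ p : S × Fin M, C p, Finset.sum_nonneg fun p _ => hC0 p, fun N hN β B δ h1 hrows hB => ?_⟩
    have hn : n ≤ N := by omega
    have hrowsn : ∀ (i : ι) (a : K), ∀ f ∈ wordTruncation (ι := ι) r n,
        δ (sderiv k i a f) = β * δ (f * S' i a) :=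
      fun i a f hf => hrows i a f (wordTruncation_mono r hn hf)
    rw [hstep β δ h1 hrowsn, abs_mul, pow_succ, Finset.sum_mul, Finset.sum_mul]
    have hB0 : 0 ≤ B := le_trans (abs_nonneg _) (hB 1 ⟨[], by simp, by simp, rfl⟩)
    have hterm : ∀ p : S × Fin M,
        |δ (sderiv k (p.1 : ι) (gen p.2) g * S' p.1 (gen p.2))| ≤ C p * B * |β| ^ q := fun p =>
      hC p N (by omega) β B δ h1 hrows fun w hw => hB w (by
        have : n + 4 + 4 * q = n + 4 * (q + 1) := by ring
        rwa [this] at hw)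
    calc |β| * |∑ i ∈ S, ∑ m : Fin M, δ (sderiv k i (gen m) g * S' i (gen m))|
        ≤ |β| * ∑ p : S × Fin M, C p * B * |β| ^ q := by
          refine mul_le_mul_of_nonneg_left ?_ (abs_nonneg _)
          rw [← Finset.sum_attach S, ← Finset.univ_eq_attach, ← Finset.sum_product']
          exact (Finset.abs_sum_le_sum_abs _ _).trans (Finset.sum_le_sum fun p _ => hterm p)
      _ = ∑ p : S × Fin M, C p * B * (|β| ^ q * |β|) := by
          rw [Finset.mul_sum]
          exact Finset.sum_congr rfl fun p _ => by ring

/-! ## The truncated bootstrap of the tree -/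

section Feasible

variable {Sact : ι → (ι → G) → ℝ}
  (hS'd : ∀ (i : ι) (a : K) (U : ι → G),
    HasDerivAt (fun t => Sact i (Function.update U i (k a t * U i))) (S' i a U) 0)

include hk hX hS'd in
/-- **The rows of a feasible functional, in operator form**: a functional feasible for the tree's
truncated bootstrap with test functions `V ⊆ polyAlgebra` satisfies
`φ (D_{i,a} f) = β φ (f · S' i a)` for all `f ∈ V` (uniqueness of derivatives identifies the action
derivative with `S' i a` and the test-function derivative with `sderiv`). -/
theorem IsBootstrapFeasible.rows_sderiv {β : ℝ} {V : Set C(ι → G, ℝ)}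
    (hV : V ⊆ polyAlgebra (ι := ι) r) {φ : C(ι → G, ℝ) →ₗ[ℝ] ℝ}
    (hφ : IsBootstrapFeasible r k Sact β V φ) (i : ι) (a : K) {f : C(ι → G, ℝ)} (hf : f ∈ V) :
    φ (sderiv k i a f) = β * φ (f * S' i a) := by
  obtain ⟨S'', -, hS''d, hrows⟩ := hφ.2.2 i a
  have he : S'' = S' i a := ContinuousMap.ext fun U => (hS''d U).unique (hS'd i a U)
  rw [← he]
  exact hrows f hf _ (sderiv_mem_polyAlgebra hk hX i a (hV hf))
    (hasShiftDeriv_sderiv_of_mem_polyAlgebra hk hX i a (hV hf))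

include hk hX hexh gen hspan hrow hnn hfaith hS' hS'd in
/-- ★★★ **The width of the truncated bootstrap is `O(|β|^q)`.** For every `h ∈ wordSpace r S n` and
every `q` there is `C ≥ 0` such that for every level `N` with `n + 4q ≤ N + 4` and `n + 4q ≤ 2N`,
every real `β` and every two functionals `φ`, `ψ` feasible for the level-`N` word-truncated bootstrap
(normalisation, squares of words of length `≤ N`, rows for test functions of length `≤ N`):
`|φ h - ψ h| ≤ C |β|^q`. [folklore mechanism; truncated statement new] -/
theorem exists_const_abs_sub_le_pow (q : ℕ) (S : Finset ι) (n : ℕ) {h : C(ι → G, ℝ)}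
    (hh : h ∈ wordSpace r (S : Set ι) n) :
    ∃ C : ℝ, 0 ≤ C ∧ ∀ (N : ℕ), n + 4 * q ≤ N + 4 → n + 4 * q ≤ 2 * N → ∀ (β : ℝ)
      (φ ψ : C(ι → G, ℝ) →ₗ[ℝ] ℝ),
      IsBootstrapFeasible r k Sact β (wordTruncation (ι := ι) r N) φ →
      IsBootstrapFeasible r k Sact β (wordTruncation (ι := ι) r N) ψ → |φ h - ψ h| ≤ C * |β| ^ q := by
  obtain ⟨C, hC0, hC⟩ := exists_const_abs_le_pow hk hX hexh gen hspan hrow hnn hfaith hS' q S n hh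
  refine ⟨C * 2, by positivity, fun N hN hN2 β φ ψ hφ hψ => ?_⟩
  have hb := hC N hN β 2 (φ - ψ) (by rw [LinearMap.sub_apply, hφ.1, hψ.1, sub_self])
    (fun i a f hf => by
      rw [LinearMap.sub_apply, LinearMap.sub_apply,
        hφ.rows_sderiv hk hX hS'd (wordTruncation_subset_polyAlgebra r N) i a hf,
        hψ.rows_sderiv hk hX hS'd (wordTruncation_subset_polyAlgebra r N) i a hf, mul_sub])
    (fun w hw => abs_sub_word_le_two r hφ hψ (wordsUpTo_mono r hN2 hw))
  rwa [LinearMap.sub_apply] at hb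

include hk hX hexh gen hspan hrow hnn hfaith hS'd in
/-- ★★★ **At `β = 0` the truncated bootstrap is EXACT from level `n` on, by the rows alone**: every
functional satisfying the level-`n` rows of the tree's truncated bootstrap at `β = 0` (feasibility
is more than enough) gives every `h ∈ wordSpace r S n` the value `(φ₀ h / φ₀ 1) φ 1`. -/
theorem IsBootstrapFeasible.apply_eq_of_zero (S : Finset ι) (n : ℕ) {φ : C(ι → G, ℝ) →ₗ[ℝ] ℝ}
    (hφ : IsBootstrapFeasible r k Sact 0 (wordTruncation (ι := ι) r n) φ) {h : C(ι → G, ℝ)}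
    (hh : h ∈ wordSpace r (S : Set ι) n) : φ h = φ₀ h / φ₀ 1 := by
  have h1 := apply_eq_of_rows_zero hk hX hexh gen hspan hrow hnn hfaith S n (φ := φ)
    (fun i a f hf => by
      rw [hφ.rows_sderiv hk hX hS'd (wordTruncation_subset_polyAlgebra r n) i a hf, zero_mul]) hh
  rw [h1, hφ.1, mul_one]

end Feasible

end Summit.QuantumFields.GaugeBoot

end
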